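import Summits.QuantumFields.YangMills.Theorems.BalabanUVNodesN08AtRecord13CoPR
import Literature.MathematicalPhysics.QuantumFieldTheory.Balaban1983to89.Node00.Record13SepCoPR
import Literature.MathematicalPhysics.QuantumFieldTheory.Balaban1983to89.Node00.Record13CarriersSepCoPR
import Literature.MathematicalPhysics.QuantumFieldTheory.Balaban1983to89.Node00.Record13ResidualsR

/-!
# BalabanUVNodes ∕ N08 AT THE v1.6 STAGE-13 RECORD OF RECORD (separated (7)-regular range, print's background, run-indexed residual 𝐓-weights) — v1.6 `CoPR` EDITION OF RECORD 13 (director-ym LINE №169 (H1) ∕ №174 PRESS WORD; FINDING №8 = node00-def-T LOCATED-8 «the residual 𝐓-weight slot `Stage12Params.Zt K` is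
RUN-BLIND while print's ζ ([Balaban1988Convergent] (1.11) p.248, (3.16)–(3.20) pp.268–269) reads the run»): def-T FILE 25 `Node00/Record13CoPR` (p529474 ✓ 3eadf656eaa8:
`structure Stage13RParams extends Stage13Params` + the ONE new field `Zr : (p : B12.RunParams) → TkResidualW F N (FluctV N) p.K`, guard `Stage13RParams.ZrUnity`, 𝐓-weights
`WtOfRecord₁₃R θ p` reading `θ.Zr p`, the C-keyed provisos `Stage13RParams.Provisos₁₃CoPR` (the nine Core rows + `zrLaws ∕ zrLocal`), view `Stage13RParams.toStage5₁₃CoPR`, datum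
`datumOfRecord₁₃CoPR`, record `IsRecordOfRecord₁₃CCoPR` + faces; run-blind embedding `Stage13RParams.ofRunBlind`) and FILE 26T `Node00/Record13SepCoPR` (p529780 ✓: `Provisos₁₃SepCoPR`,
`datumOfRecord₁₃SepCoPR`, `IsRecordOfRecord₁₃CSepCoPR` + `.toCoPR`); dag-n10-d's R carrier leaves `Node00/Record13CarriersCoPR` (p530591 ✓: §0 THE R-PIN ALGEBRA `Stage13RParams.onBase ∕ rebindX ∕
pin<G>` (dag-lead DEDUP-286 (2), this seat's DESIGN-INPUT-R), `toStage5₁₃CoPR_rebindX ∕ _pin<G>`, `Provisos₁₃CoPR.rebindX ∕ .pin<G>`, `datumOfRecord₁₃CoPR_rebindX ∕ _pin<G>`,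
`isRecordOfRecord₁₃CCoPR_rebindX_of_eq ∕ _pinB10_of_eq`, `exists_world_isRecordOfRecord₁₃CCoPR_rebindX`, the R views `Stage13RParams.view₁₃CoPRB10YZW ∕ …B8B10YZW` + `_eq` + `_leaves`) and
`Node00/Record13CarriersSepCoPR` (n10-d file (2), in the tree 12:36Z: `Provisos₁₃SepCoPR.pin<G>`, `datumOfRecord₁₃SepCoPR_pin<G>`, `isRecordOfRecord₁₃CSepCoPR_pinB10_of_eq`).  Token map T₆ (plan IMPACT-169, def-T KEYMAP v1.6,
dag-lead WORDS-142): «the v1.5 names with `CoP ↦ CoPR`, binders `Stage13Params ↦ Stage13RParams`, `ZtUnity ↦ ZrUnity`, `Provisos₁₃Core ↦ Provisos₁₃CoPR` (C-keyed family), `θ.Zt p.K ↦ θ.Zr p`».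
# THIS FILE = the T₆ image of ★ ROW A2 `BalabanUVNodesN08AtRecord13SepCoP` (p524458: N08's ₁₃ ∃-currency at the record plan's items key on) (Track A, DAG node N08 [Balaban1985UV3] CMP **102** (1985) 255, Thm 1 p. 257 (compact reading) + Thm 2 p. 272; R134 fan-out seat `pub-ymgap-dag-n08-c` g16, strategy s2
«knit at the record of record», trigger (t27) = №174 (3) «pens port their OWN files»; 2026-08-27)

WHY THIS FILE.  Route «BalabanUVNodes» re-keys (plan rev 22∕23, ⁵ → ⁶) on FILE 26T's names: the K0⁶ text reads `∃ θ : Stage13RParams F 2, θ.Provisos₁₃SepCoPR F 2 ∧ (θ.ZrUnity F 2 ∧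
θ.SlotsNondegenerate₁₃ F 2) ∧ θ.Admissible F 2`, and the K1⁶ rung 1 PINS NODE N08 BY NAME as the conjunct `Node00.PrintedUV3V 2 θ.L` (plan K1 skeleton v4 = T₆(v3∕v3.1)).  The ⁵ storey
p524458 is keyed on `Stage13Params ∕ Provisos₁₃SepCoP ∕ datumOfRecord₁₃SepCoP ∕ IsRecordOfRecord₁₃CSepCoP` — NOT instantiable from `h : θ.Provisos₁₃SepCoPR F N` (no map ⁶ → ⁵: FINDING №8 is
exactly that asymmetry; only def-T's run-blind embedding `ofRunBlind` goes ⁵ → ⁶).  So the ∃-CURRENCY — and only it — is re-typed here as the IMAGE of p524458 under T₆ (17 ∕ 17 images);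
the POINTED closers are the CoPR storey's §1 (`N08AtRecord13CoPR.b10_main_of_up_pinB10 ∕ _view₁₃CoPRB10YZW`, proviso-free), the §0 guards are the CoPR storey's §0 along
`IsRecordOfRecord₁₃CSepCoPR.toCoPR`, and the guard-per-pin faces are the CoPR storey's §0a `N08AtRecord13CoPR.guard_pin<G>_iff` (`Stage13RParams`-level, `Iff.rfl`).
HONEST DEPARTURES FROM A PURE TOKEN IMAGE (generator `tools/copr_n08_gen.py` + `tools/genericize_witness_n08.py`; every other statement SHAPE verbatim, proofs re-checked):
(i) the 𝐑-bundle `WOfRecord₁₃` (12a; reads no 𝐓-slot, NOT re-issued by def-T) is fed the base `θ.toStage13Params` (plan's K1 v4 text does the same); (ii) every WITNESS-LINE theorem is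
stated at the R-LIFT `⟨θ₀, Zr⟩ : Stage13RParams F N` of node00-def-K0a's v1.5 maker `θ₀` (`theta13LiveOfRecord ∕ theta13LiveOfNumerics … ∕ theta13LiveOfFamily₂ …`, θ-level and
background-free) by an ARBITRARY run-indexed residual family `Zr`; admissibility and `SlotsNondegenerate₁₃` of the lift ARE K0a's faces of `θ₀` through the base (definitional), while
the guard half `ZrUnity` — whose K0a hypothesis-free face `ztUnity_…` has no R image until K0a pins `Zr` (№174 (5)) — is DISPLAYED as `hZ` in the `N = 2` forms (K0a FILE 17
`ZrOfRecord₁₃ ∕ finsum_ζ0_ZrOfRecord₁₃`, dag-n11-d's diagonal cure as a definition, discharges it at `Zr := ZrOfRecord₁₃ F N θ₀`: `fun p j ω => finsum_ζ0_ZrOfRecord₁₃ …`).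

WHAT IS PROVED (all bookkeeping BY NAME, one `exact`∕`obtain` each):
* §0 the in-edge guards `b4 b5 b6 b7` at every run of every ₁₃CSepCoPR record (`.toCoPR` + the CoPR storey's `guards_of_isRecordOfRecord₁₃CCoPR`), hence N08 there reads `b8 → b9 → b11 → b10`;
* §0b the v1.6 record over the [B10]-PINNED and over the FOUR-PIN R view at `datumOfRecord₁₃SepCoPR θ h` (n10-d's `Provisos₁₃SepCoPR.pin<G>`, `datumOfRecord₁₃SepCoPR_pin<G>`,
  `isRecordOfRecord₁₃CSepCoPR_pinB10_of_eq`, `view₁₃CoPRB10YZW_eq`), and their existence at any window `0 < γw ≤ θ.γ`;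
* §2 THE ∃-CURRENCY: from `θ`, `h : θ.Provisos₁₃SepCoPR F N`, admissibility and `PrintedUV3V N θ.L` — a world that IS a ₁₃CSepCoPR record of `datumOfRecord₁₃SepCoPR θ h`, bound over
  the pinned ∕ four-pin R view, carrying N08 at every run; the PINNED and FOUR-PIN PRESENTATIONS (same datum, guard and admissibility read AT the presenting parameter, the pin
  returned AT it); and «THE K0⁶ ANTECEDENT `∃ θ, Provisos₁₃SepCoPR ∧ (ZrUnity ∧ SlotsNondegenerate₁₃) ∧ Admissible` + the slot at every odd `L > 1` ⟹ N08's conjunct of rung 1 WITH ITS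
  PIN `PrintedUV3V N θ.L`» (`…_of_inhabited13SepCoPR`; `_two` at `N = 2`, hypothesis = the K0⁶ body at `F` VERBATIM);
* §2S THE S-BOUND PRESENTATION (plan's REGISTERED rung 1 v4 binds its world to the S-class `RecordS` = `IsRecordOfRecord₁₃CSepCoPR` with `upOfRecord₅C ↦ upOfRecord₅CS`; tree twin WANTED —
  inlined verbatim): an S-bound world in the S-class of the datum carrying N08 from the slot, and «K0⁶ antecedent + slot socket ⟹ N08's SLICE OF `NodesAtSomeRecord13PWS`» (`_two`, `N = 2`);
* §3 on the R-lifts `⟨θ₁₃, Zr⟩` of the WITNESS LINE OF RECORD `θ₁₃ = theta13LiveOfRecord F N` (`L = F.L`, `γ = 1∕2`): N08's share costs `hP : Provisos₁₃SepCoPR` there (HYPOTHESIS, opaque) +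
  `PrintedUV3V N F.L` (+ `hZ` at `N = 2`);
* §4 the same at the R-lifts of K0a's all-numerics family `theta13LiveOfNumerics n ε₂₉ …` (`γ = n.γ`; every K0⁶ witness candidate `⟨θ₁₅…, ZrOfRecord₁₃ …⟩` is such a lift) and two-letter
  family `theta13LiveOfFamily₂ ε₀ ε₂₉ …` (`γ = 1∕2`) — provisos OPAQUE (`hP : ….Provisos₁₃SepCoPR F N`; no `bg` socket text here: the ⁶ socket is node00-def-K0a's, not this seat's).

HONEST FRAMING.  Count-neutral kernel bookkeeping BY NAME — a re-keying of a LANDED storey to the re-issued record (new file; p524458 stays as the ⁵ sibling of record).  NOT A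
DISCHARGE OF N08: `PrintedUV3V` is TYPED and DISPLAYED as a hypothesis (resp. returned as the pin), NOT PROVED — an inhabitant (the [B10] cluster expansion at print's run objects)
remains THE object gap; `Provisos₁₃(Sep)CoPR`, admissibility and the guard are hypotheses or K0a's theorems, never asserted; K0 ∕ K1 neither proved nor assumed; nothing of
Bałaban's asserted; one finite four-torus per run at fixed `ε`, [B10]'s d = 3 lattices inside the record; nothing continuum ∕ ℝ⁴ ∕ OS ∕ mass gap ∕ Clay.  0 `sorry`, 0 `def`, standard axioms.
Sources: [Balaban1985UV3] Thm 1 p.257, Thm 2 p.272; [Balaban1989LargeFieldII] Thm 1 + (0.1) pp.355–356; [Balaban1988Convergent] (1.11) p.248, (2.18) p.257, (2.28) p.259,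
(3.16)–(3.22) pp.268–269; [Balaban1985Variational] (5)–(7) p.278 (print's background, regular data); [Balaban1985RegularSpaces] (1.3)–(1.9) pp.76–77; [Balaban1987RG1] (0.21) p.256, (2.9) p.266.
-/

noncomputable section

namespace Summit.QuantumFields.YangMills.BalabanUVNodes.N08AtRecord13SepCoPR

open Literature.MathematicalPhysics.QuantumFieldTheory.Balaban1983to89
open Literature.MathematicalPhysics.QuantumFieldTheory.Balaban1983to89.T4Continuum (T4Family FiniteEpsData)
open Literature.MathematicalPhysics.QuantumFieldTheory.Balaban1983to89.DagBinding
  (WorldP leavesP PrintedCarriersR PrintedCarriers9X PrintedCarriers11 PrintedCarriers15)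
open Literature.MathematicalPhysics.QuantumFieldTheory.Balaban1983to89.Node00
open Summit.QuantumFields.YangMills.BalabanUVNodes.N08AtRecord13CoPR
open scoped Matrix.Norms.L2Operator

variable {F : T4Family} {N : ℕ} [NeZero N]

/-! ## §0 THE IN-EDGE GUARDS AT EVERY RUN OF EVERY v1.6 STAGE-13 RECORD — keyed once on the core (`.toCoPR`) -/

section Guards
variable {D : FiniteEpsData F (SU N)} {w : WorldP}

/-- **In-edge guards at every run of a ₁₃CSepCoPR record**: the leaves `b4`, `b5`, `b6`, `b7` HOLD — N01 ∕ N02 ∕ N03 ∕ N04 are NODE 00 theorems at the Stage-5 shadow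
(`Node00.b4∕b5∕b7_main_of_isRecordOfRecord₅C`, `Node00.N03_at_record₅C`), read through `IsRecordOfRecord₁₃CSepCoPR.toCoPR` from the CoPR storey's `N08AtRecord13CoPR.guards_of_isRecordOfRecord₁₃CCoPR` (FILE 23's `atWorld_of_isRecordOfRecord₁₃CCoPR`).
[cite: Balaban1983RegularityDecay, Theorem p.573; Balaban1984PropagatorsI, Props. 1.1–1.2 pp.33–36; Balaban1984PropagatorsII, Lemma 2.1 – Cor. 2.8 pp.234–249; Balaban1985Averaging, Props. 1–10 pp.26–50 (kernel versions at the objects of record; bookkeeping, transferred)] -/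
theorem guards_of_isRecordOfRecord₁₃CSepCoPR (h : IsRecordOfRecord₁₃CSepCoPR F N D w) (P : B12.RunParams) :
    (leavesP w P).b4 ∧ (leavesP w P).b5 ∧ (leavesP w P).b6 ∧ (leavesP w P).b7 :=
  guards_of_isRecordOfRecord₁₃CCoPR h.toCoPR P

/-- Hence at a ₁₃CSepCoPR record N08 reads `b8 → b9 → b11 → b10` (the in-edges `b5 b6 b7` drop out). [cite: Balaban1985UV3, Thm 1 p.257, Thm 2 p.272 (bookkeeping)] -/
theorem b10_main_iff_residual_of_isRecordOfRecord₁₃CSepCoPR (h : IsRecordOfRecord₁₃CSepCoPR F N D w) (P : B12.RunParams) :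
    Dag.B10_main (leavesP w P) ↔ ((leavesP w P).b8 → (leavesP w P).b9 → (leavesP w P).b11 → (leavesP w P).b10) :=
  b10_main_iff_residual_of_isRecordOfRecord₁₃CCoPR h.toCoPR P

end Guards

/-! ## §0b THE v1.6 RECORD OVER THE [B10]-PINNED ∕ FOUR-PIN CoPR VIEW, over dag-n10-d's leaf `Node00/Record13CarriersSepCoPR` v1.6 twins
(`Provisos₁₃SepCoPR.pin<G>`, `datumOfRecord₁₃SepCoPR_pin<G>`, `isRecordOfRecord₁₃CSepCoPR_pinB10_of_eq`) BY NAME; the guard and admissibility faces per pin are θ-level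
(p491313 §0b `guard_pin<G>_iff`, n10-d `Stage13RParams.pin<G>_admissible_iff`, all `Iff.rfl`) and serve verbatim -/

section PinFaces
variable (θ : Stage13RParams F N)

/-- **EVERY admissible Stage-13 parameter with v1.6 provisos presents a ₁₃CSepCoPR record at its own datum whose world is bound over the [B10]-PINNED CoPR view**,
any window `0 < γw ≤ θ.γ`, block size `θ.L` (def-T's world construction at `θ.pinB10`, through n10-d's `isRecordOfRecord₁₃CSepCoPR_pinB10_of_eq`). [cite: Balaban1989LargeFieldII, Thm 1 + (0.1) pp.355–356 (bookkeeping)] -/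
theorem exists_world_isRecordOfRecord₁₃CSepCoPR_pinB10 (h : θ.Provisos₁₃SepCoPR F N) (hθ : θ.Admissible F N) {γw : ℝ} (hγw : 0 < γw ∧ γw ≤ θ.γ) :
    ∃ w : WorldP, IsRecordOfRecord₁₃CSepCoPR F N (datumOfRecord₁₃SepCoPR F N θ h) w ∧ w.γ = γw ∧ w.L = (θ.L : ℝ) ∧
      ∀ P, w.up P = upOfRecord₅C F N ((θ.pinB10 F N).toStage5₁₃CoPR F N) P := by
  obtain ⟨w₀⟩ := nonempty_worldP
  exact ⟨{ w₀ with
      C := (datumOfRecord₁₃SepCoPR F N θ h).C, γ := γw, L := (θ.L : ℝ), one_lt_L := by exact_mod_cast θ.hL.2,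
      up := fun P => upOfRecord₅C F N ((θ.pinB10 F N).toStage5₁₃CoPR F N) P },
    isRecordOfRecord₁₃CSepCoPR_pinB10_of_eq F N θ h hθ _ rfl hγw rfl (fun _ => rfl), rfl, rfl, fun _ => rfl⟩

/-- **A world with def-T's pointed clauses bound over n10-d's FOUR-PIN Stage-13 view IS a ₁₃CSepCoPR record AT `datumOfRecord₁₃SepCoPR θ h`** (presenting parameter the quadruply
pinned `θ`; v1.6 provisos transported pin by pin, datum by the four `rfl`s, view by `view₁₃CoPRB10YZW_eq` — p514601 §0b re-keyed).
[cite: Balaban1989LargeFieldII, Thm 1 + (0.1) pp.355–356 (bookkeeping)] -/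
theorem isRecordOfRecord₁₃CSepCoPR_view₁₃CoPRB10YZW_of_eq (h : θ.Provisos₁₃SepCoPR F N) (hθ : θ.Admissible F N) (Mstar : ℕ) (ops : OpsY N θ.toStage3Params Mstar)
    (ζ : ResidZ F N) (lamW : ResidW F N) (w : WorldP) (hC : w.C = (datumOfRecord₁₃SepCoPR F N θ h).C) (hγ : 0 < w.γ ∧ w.γ ≤ θ.γ) (hL : w.L = (θ.L : ℝ))
    (hup : ∀ P, w.up P = upOfRecord₅C F N (θ.view₁₃CoPRB10YZW F N Mstar ops ζ lamW) P) :
    IsRecordOfRecord₁₃CSepCoPR F N (datumOfRecord₁₃SepCoPR F N θ h) w := by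
  have h₁ : (θ.pinB10 F N).Provisos₁₃SepCoPR F N := h.pinB10
  have h₂ : ((θ.pinB10 F N).pinY F N (Y9OfRecord N θ.toStage3Params Mstar ops)).Provisos₁₃SepCoPR F N := h₁.pinY _
  have h₃ : (((θ.pinB10 F N).pinY F N (Y9OfRecord N θ.toStage3Params Mstar ops)).pinZ F N (Z11OfRecord F N ζ)).Provisos₁₃SepCoPR F N := h₂.pinZ _
  have h₄ : ((((θ.pinB10 F N).pinY F N (Y9OfRecord N θ.toStage3Params Mstar ops)).pinZ F N (Z11OfRecord F N ζ)).pinW F N (WOfRecord₁₃ F N θ.toStage13Params lamW)).Provisos₁₃SepCoPR F N :=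
    h₃.pinW _
  have hθ' : ((((θ.pinB10 F N).pinY F N (Y9OfRecord N θ.toStage3Params Mstar ops)).pinZ F N (Z11OfRecord F N ζ)).pinW F N (WOfRecord₁₃ F N θ.toStage13Params lamW)).Admissible F N :=
    (Stage13Params.pinW_admissible_iff F N _ _).2 ((Stage13Params.pinZ_admissible_iff F N _ _).2
      ((Stage13Params.pinY_admissible_iff F N _ _).2 ((Stage13Params.pinB10_admissible_iff F N _).2 hθ)))
  refine ⟨_, h₄, hθ', ?_, hC, hγ, hL, fun P => ?_⟩
  · rw [datumOfRecord₁₃SepCoPR_pinW F N _ h₃, datumOfRecord₁₃SepCoPR_pinZ F N _ h₂, datumOfRecord₁₃SepCoPR_pinY F N _ h₁, datumOfRecord₁₃SepCoPR_pinB10 F N θ h]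
  · rw [hup P, Stage13RParams.view₁₃CoPRB10YZW_eq]

/-- … hence EVERY admissible Stage-13 parameter with v1.6 provisos presents a ₁₃CSepCoPR record at its own datum whose world is bound over the FOUR-PIN CoPR view
(package EXPOSED: any floor `Mstar`, operator layer `ops`, [B11] layer `ζ`, [IV] layer `lamW`), any window, block size `θ.L`. [cite: Balaban1989LargeFieldII, Thm 1 + (0.1) pp.355–356 (bookkeeping)] -/
theorem exists_world_isRecordOfRecord₁₃CSepCoPR_view₁₃CoPRB10YZW (h : θ.Provisos₁₃SepCoPR F N) (hθ : θ.Admissible F N) (Mstar : ℕ) (ops : OpsY N θ.toStage3Params Mstar)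
    (ζ : ResidZ F N) (lamW : ResidW F N) {γw : ℝ} (hγw : 0 < γw ∧ γw ≤ θ.γ) :
    ∃ w : WorldP, IsRecordOfRecord₁₃CSepCoPR F N (datumOfRecord₁₃SepCoPR F N θ h) w ∧ w.γ = γw ∧ w.L = (θ.L : ℝ) ∧
      ∀ P, w.up P = upOfRecord₅C F N (θ.view₁₃CoPRB10YZW F N Mstar ops ζ lamW) P := by
  obtain ⟨w₀⟩ := nonempty_worldP
  exact ⟨{ w₀ with
      C := (datumOfRecord₁₃SepCoPR F N θ h).C, γ := γw, L := (θ.L : ℝ), one_lt_L := by exact_mod_cast θ.hL.2,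
      up := fun P => upOfRecord₅C F N (θ.view₁₃CoPRB10YZW F N Mstar ops ζ lamW) P },
    isRecordOfRecord₁₃CSepCoPR_view₁₃CoPRB10YZW_of_eq θ h hθ Mstar ops ζ lamW _ rfl hγw rfl (fun _ => rfl), rfl, rfl, fun _ => rfl⟩

end PinFaces

/-! ## §2 THE ∃-CURRENCY OF THE rev-20 NODES STUB — N08's conjunct at the v1.6 record, the guard riding on `θ`, and the rung-1 PIN `PrintedUV3V N θ.L` -/

section Currency

/-- **AT THE DATUM OF ANY ADMISSIBLE STAGE-13 TUPLE WITH v1.6 PROVISOS, a world (any window height `γw`, block size `θ.L`) that IS a ₁₃CSepCoPR record of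
`datumOfRecord₁₃SepCoPR F N θ h`, bound over the [B10]-PINNED CoPR view, carrying N08 at every run — from the one slot instance `PrintedUV3V N θ.L`** (§0b + the CoPR storey's
proviso-free pointed closer `N08AtRecord13CoPR.b10_main_of_up_pinB10`). [cite: Balaban1985UV3, Thm 1 p.257, Thm 2 p.272; Balaban1989LargeFieldII, Thm 1 + (0.1) pp.355–356 (the record's world; bookkeeping)] -/
theorem exists_world₁₃CSepCoPR_b10_main_of_slot (θ : Stage13RParams F N) (h : θ.Provisos₁₃SepCoPR F N) (hθ : θ.Admissible F N) {γw : ℝ} (hγw : 0 < γw ∧ γw ≤ θ.γ)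
    (hUV : PrintedUV3V N θ.L) :
    ∃ w : WorldP, IsRecordOfRecord₁₃CSepCoPR F N (datumOfRecord₁₃SepCoPR F N θ h) w ∧ w.γ = γw ∧ w.L = (θ.L : ℝ) ∧
      (∀ P, w.up P = upOfRecord₅C F N ((θ.pinB10 F N).toStage5₁₃CoPR F N) P) ∧ ∀ P : B12.RunParams, Dag.B10_main (leavesP w P) := by
  obtain ⟨w, hR, hγ, hL, hup⟩ := exists_world_isRecordOfRecord₁₃CSepCoPR_pinB10 θ h hθ hγw
  exact ⟨w, hR, hγ, hL, hup, b10_main_of_up_pinB10 θ hup hUV⟩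

/-- **The four-pin twin** (package EXPOSED): at the same datum a world bound over `θ.view₁₃CoPRB10YZW Mstar ops ζ lamW` that IS a ₁₃CSepCoPR record and carries N08 at every run,
from `PrintedUV3V N θ.L` — the world at which the other nodes' pointed closers over the four-pin view apply. [cite: Balaban1985UV3, Thm 1 p.257, Thm 2 p.272; Balaban1989LargeFieldII, Thm 1 + (0.1) pp.355–356 (bookkeeping)] -/
theorem exists_world₁₃CSepCoPR_view₁₃CoPRB10YZW_b10_main_of_slot (θ : Stage13RParams F N) (h : θ.Provisos₁₃SepCoPR F N) (hθ : θ.Admissible F N) (Mstar : ℕ)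
    (ops : OpsY N θ.toStage3Params Mstar) (ζ : ResidZ F N) (lamW : ResidW F N) {γw : ℝ} (hγw : 0 < γw ∧ γw ≤ θ.γ) (hUV : PrintedUV3V N θ.L) :
    ∃ w : WorldP, IsRecordOfRecord₁₃CSepCoPR F N (datumOfRecord₁₃SepCoPR F N θ h) w ∧ w.γ = γw ∧ w.L = (θ.L : ℝ) ∧
      (∀ P, w.up P = upOfRecord₅C F N (θ.view₁₃CoPRB10YZW F N Mstar ops ζ lamW) P) ∧ ∀ P : B12.RunParams, Dag.B10_main (leavesP w P) := by
  obtain ⟨w, hR, hγ, hL, hup⟩ := exists_world_isRecordOfRecord₁₃CSepCoPR_view₁₃CoPRB10YZW θ h hθ Mstar ops ζ lamW hγw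
  exact ⟨w, hR, hγ, hL, hup, b10_main_of_up_view₁₃CoPRB10YZW θ Mstar ops ζ lamW hup hUV⟩

/-- **THE PINNED PRESENTATION** at the v1.6 record: from `θ`, its v1.6 provisos, admissibility and guard, and `PrintedUV3V N θ.L` — a presenting
parameter `θ' := θ.pinB10` with provisos `h'`, THE SAME datum (`datumOfRecord₁₃SepCoPR_pinB10`), the guard and admissibility read AT `θ'` (carrier-blind), a world bound over
`θ'.toStage5₁₃CoPR` that IS a ₁₃CSepCoPR record and carries N08 at every run, AND THE PIN READ AT `θ'` (`θ'.L = θ.L`, `rfl`). [cite: Balaban1985UV3, Thm 1 p.257, Thm 2 p.272; Balaban1989LargeFieldII, Thm 1 + (0.1) pp.355–356; Balaban1988Convergent, (3.16)–(3.22) pp.268–269 (the guard; bookkeeping)] -/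
theorem exists_pinned_presentation₁₃CSepCoPR_b10_main (θ : Stage13RParams F N) (h : θ.Provisos₁₃SepCoPR F N) (hθ : θ.Admissible F N)
    (hG : θ.ZrUnity F N ∧ θ.SlotsNondegenerate₁₃ F N) {γw : ℝ} (hγw : 0 < γw ∧ γw ≤ θ.γ) (hUV : PrintedUV3V N θ.L) :
    ∃ (θ' : Stage13RParams F N) (h' : θ'.Provisos₁₃SepCoPR F N) (w : WorldP), (θ'.ZrUnity F N ∧ θ'.SlotsNondegenerate₁₃ F N) ∧ θ'.Admissible F N ∧
      datumOfRecord₁₃SepCoPR F N θ' h' = datumOfRecord₁₃SepCoPR F N θ h ∧ w.C = (datumOfRecord₁₃SepCoPR F N θ' h').C ∧ (0 < w.γ ∧ w.γ ≤ θ'.γ) ∧ w.γ = γw ∧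
      w.L = (θ'.L : ℝ) ∧ (∀ P, w.up P = upOfRecord₅C F N (θ'.toStage5₁₃CoPR F N) P) ∧ IsRecordOfRecord₁₃CSepCoPR F N (datumOfRecord₁₃SepCoPR F N θ h) w ∧
      (∀ P : B12.RunParams, Dag.B10_main (leavesP w P)) ∧ PrintedUV3V N θ'.L := by
  obtain ⟨w, hR, hγ, hL, hup, hN⟩ := exists_world₁₃CSepCoPR_b10_main_of_slot θ h hθ hγw hUV
  refine ⟨θ.pinB10 F N, h.pinB10, w, (N08AtRecord13CoPR.guard_pinB10_iff θ).2 hG, (Stage13Params.pinB10_admissible_iff F N θ.toStage13Params).2 hθ,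
    datumOfRecord₁₃SepCoPR_pinB10 F N θ h, ?_, ?_, hγ, hL, fun P => (hup P).trans (by rw [Stage13RParams.toStage5₁₃CoPR_pinB10]), hR, hN, hUV⟩
  · rw [datumOfRecord₁₃SepCoPR_pinB10 F N θ h]; exact construction_eq_of_isRecordOfRecord₁₃CSepCoPR hR
  · rw [hγ]; exact hγw

/-- **THE FOUR-PIN PRESENTATION** at the v1.6 record (package EXPOSED): presenting parameter `θ' := (((θ.pinB10).pinY (Y9OfRecord …)).pinZ (Z11OfRecord ζ)).pinW
(WOfRecord₁₃ θ lamW)` — THE SAME datum (the four `datumOfRecord₁₃SepCoPR_pin<G>`), guard and admissibility read AT `θ'` (pin-blind), a world bound over `θ'.toStage5₁₃CoPR`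
(= `θ.view₁₃CoPRB10YZW …`, `view₁₃CoPRB10YZW_eq`) that IS a ₁₃CSepCoPR record of `datumOfRecord₁₃SepCoPR θ h` and carries N08 at every run — from `PrintedUV3V N θ.L`, WITH THE PIN READ AT `θ'`.
[cite: Balaban1985UV3, Thm 1 p.257, Thm 2 p.272; Balaban1989LargeFieldII, Thm 1 + (0.1) pp.355–356; Balaban1988Convergent, (3.16)–(3.22) pp.268–269 (bookkeeping)] -/
theorem exists_pinned4_presentation₁₃CSepCoPR_b10_main (θ : Stage13RParams F N) (h : θ.Provisos₁₃SepCoPR F N) (hθ : θ.Admissible F N)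
    (hG : θ.ZrUnity F N ∧ θ.SlotsNondegenerate₁₃ F N) (Mstar : ℕ) (ops : OpsY N θ.toStage3Params Mstar) (ζ : ResidZ F N) (lamW : ResidW F N) {γw : ℝ}
    (hγw : 0 < γw ∧ γw ≤ θ.γ) (hUV : PrintedUV3V N θ.L) :
    ∃ (θ' : Stage13RParams F N) (h' : θ'.Provisos₁₃SepCoPR F N) (w : WorldP), (θ'.ZrUnity F N ∧ θ'.SlotsNondegenerate₁₃ F N) ∧ θ'.Admissible F N ∧
      datumOfRecord₁₃SepCoPR F N θ' h' = datumOfRecord₁₃SepCoPR F N θ h ∧ w.C = (datumOfRecord₁₃SepCoPR F N θ' h').C ∧ (0 < w.γ ∧ w.γ ≤ θ'.γ) ∧ w.γ = γw ∧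
      w.L = (θ'.L : ℝ) ∧ (∀ P, w.up P = upOfRecord₅C F N (θ'.toStage5₁₃CoPR F N) P) ∧ (∀ P, w.up P = upOfRecord₅C F N (θ.view₁₃CoPRB10YZW F N Mstar ops ζ lamW) P) ∧
      IsRecordOfRecord₁₃CSepCoPR F N (datumOfRecord₁₃SepCoPR F N θ h) w ∧ (∀ P : B12.RunParams, Dag.B10_main (leavesP w P)) ∧ PrintedUV3V N θ'.L := by
  obtain ⟨w, hR, hγ, hL, hup, hN⟩ := exists_world₁₃CSepCoPR_view₁₃CoPRB10YZW_b10_main_of_slot θ h hθ Mstar ops ζ lamW hγw hUV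
  have h₁ : (θ.pinB10 F N).Provisos₁₃SepCoPR F N := h.pinB10
  have h₂ : ((θ.pinB10 F N).pinY F N (Y9OfRecord N θ.toStage3Params Mstar ops)).Provisos₁₃SepCoPR F N := h₁.pinY _
  have h₃ : (((θ.pinB10 F N).pinY F N (Y9OfRecord N θ.toStage3Params Mstar ops)).pinZ F N (Z11OfRecord F N ζ)).Provisos₁₃SepCoPR F N := h₂.pinZ _
  have h₄ : ((((θ.pinB10 F N).pinY F N (Y9OfRecord N θ.toStage3Params Mstar ops)).pinZ F N (Z11OfRecord F N ζ)).pinW F N (WOfRecord₁₃ F N θ.toStage13Params lamW)).Provisos₁₃SepCoPR F N :=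
    h₃.pinW _
  have hD : datumOfRecord₁₃SepCoPR F N _ h₄ = datumOfRecord₁₃SepCoPR F N θ h := by
    rw [datumOfRecord₁₃SepCoPR_pinW F N _ h₃, datumOfRecord₁₃SepCoPR_pinZ F N _ h₂, datumOfRecord₁₃SepCoPR_pinY F N _ h₁, datumOfRecord₁₃SepCoPR_pinB10 F N θ h]
  refine ⟨_, h₄, w,
    (N08AtRecord13CoPR.guard_pinW_iff _ _).2 ((N08AtRecord13CoPR.guard_pinZ_iff _ _).2 ((N08AtRecord13CoPR.guard_pinY_iff _ _).2 ((N08AtRecord13CoPR.guard_pinB10_iff θ).2 hG))),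
    (Stage13Params.pinW_admissible_iff F N _ _).2 ((Stage13Params.pinZ_admissible_iff F N _ _).2
      ((Stage13Params.pinY_admissible_iff F N _ _).2 ((Stage13Params.pinB10_admissible_iff F N _).2 hθ))),
    hD, ?_, ?_, hγ, hL, fun P => (hup P).trans (by rw [Stage13RParams.view₁₃CoPRB10YZW_eq]), hup, hR, hN, hUV⟩
  · rw [hD]; exact construction_eq_of_isRecordOfRecord₁₃CSepCoPR hR
  · rw [hγ]; exact hγw

/-- **«THE K0 ANTECEDENT (v1.6 key) ⟹ N08's CONJUNCT OF RUNG 1, WITH ITS PIN»**, generic `N`: from `∃ θ, Provisos₁₃SepCoPR ∧ (ZrUnity ∧ SlotsNondegenerate₁₃) ∧ Admissible` at `F`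
(HYPOTHESIS `hI`, the guard bundled as ONE conjunct and carried to the SAME `θ` untouched) and the slot of record at every odd `L > 1` (HYPOTHESIS `hUV`, the node's object
gap), SOME guarded admissible tuple `θ`, v1.6 provisos `h` and world `w` with `IsRecordOfRecord₁₃CSepCoPR F N (datumOfRecord₁₃SepCoPR F N θ h) w`, `Dag.B10_main` at every
run (`γw := θ.γ`), AND `PrintedUV3V N θ.L` (plan's rung-1 pin, read at this `θ`).  NOT the stub (twelve conjuncts missing), NOT a discharge. [cite: Balaban1985UV3, Thm 1 p.257, Thm 2 p.272; Balaban1989LargeFieldII, Thm 1 + (0.1) pp.355–356; Balaban1988Convergent, (3.16)–(3.22) pp.268–269 (bookkeeping)] -/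
theorem exists_guarded_record₁₃CSepCoPR_b10_main_of_inhabited13SepCoPR
    (hI : ∃ θ : Stage13RParams F N, θ.Provisos₁₃SepCoPR F N ∧ (θ.ZrUnity F N ∧ θ.SlotsNondegenerate₁₃ F N) ∧ θ.Admissible F N)
    (hUV : ∀ L : ℕ, Odd L → 1 < L → PrintedUV3V N L) :
    ∃ (θ : Stage13RParams F N) (h : θ.Provisos₁₃SepCoPR F N) (w : WorldP), (θ.ZrUnity F N ∧ θ.SlotsNondegenerate₁₃ F N) ∧ θ.Admissible F N ∧
      IsRecordOfRecord₁₃CSepCoPR F N (datumOfRecord₁₃SepCoPR F N θ h) w ∧ (∀ P : B12.RunParams, Dag.B10_main (leavesP w P)) ∧ PrintedUV3V N θ.L := by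
  obtain ⟨θ, h, hG, hθ⟩ := hI
  have hUVθ : PrintedUV3V N θ.L := hUV θ.L θ.hL.1 θ.hL.2
  obtain ⟨w, hR, -, -, -, hN⟩ := exists_world₁₃CSepCoPR_b10_main_of_slot θ h hθ ⟨hθ.toStage9.gamma_pos, le_rfl⟩ hUVθ
  exact ⟨θ, h, w, hG, hθ, hR, hN, hUVθ⟩

/-- **THE SAME AT THE GROUP OF RECORD `N = 2`, hypothesis = the rev-20 K0 text** (plan's rev-18 `Record13SepInhabited` body at `F` under KEY-21T `Provisos₁₃Sep ↦ Provisos₁₃SepCoPR`, director-ym №142 (S3):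
`∃ θ : Stage13RParams F 2, θ.Provisos₁₃SepCoPR F 2 ∧ (θ.ZrUnity F 2 ∧ θ.SlotsNondegenerate₁₃ F 2) ∧ θ.Admissible F 2`): N08's conjunct of rung 1 `NodesAtSomeRecord13P`
from it and the slot at every odd `L > 1`, with the pin `PrintedUV3V 2 θ.L`.  NOT the stub, NOT a discharge. [cite: Balaban1985UV3, Thm 1 p.257, Thm 2 p.272; Balaban1989LargeFieldII, Thm 1 + (0.1) pp.355–356 (bookkeeping)] -/
theorem exists_guarded_record₁₃CSepCoPR_b10_main_of_inhabited13SepCoPR_two (F : T4Family)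
    (hI : ∃ θ : Stage13RParams F 2, θ.Provisos₁₃SepCoPR F 2 ∧ (θ.ZrUnity F 2 ∧ θ.SlotsNondegenerate₁₃ F 2) ∧ θ.Admissible F 2)
    (hUV : ∀ L : ℕ, Odd L → 1 < L → PrintedUV3V 2 L) :
    ∃ (θ : Stage13RParams F 2) (h : θ.Provisos₁₃SepCoPR F 2) (w : WorldP), (θ.ZrUnity F 2 ∧ θ.SlotsNondegenerate₁₃ F 2) ∧ θ.Admissible F 2 ∧
      IsRecordOfRecord₁₃CSepCoPR F 2 (datumOfRecord₁₃SepCoPR F 2 θ h) w ∧ (∀ P : B12.RunParams, Dag.B10_main (leavesP w P)) ∧ PrintedUV3V 2 θ.L :=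
  exists_guarded_record₁₃CSepCoPR_b10_main_of_inhabited13SepCoPR hI hUV

end Currency

/-! ## §2S THE S-BOUND PRESENTATION — N08's slice of plan's REGISTERED rung 1 v4 `NodesAtSomeRecord13PWS` (v3.1: the world is bound to the S-BOUND record class `RecordS` = def-T's
`IsRecordOfRecord₁₃CSepCoPR` with ONE token changed, `upOfRecord₅C ↦ upOfRecord₅CS` — node00-def `Node00/CarriersB8.lean` :288, the C-binding `.withB8 (B8LeafRS …)`; plan g69 PROBE-K1V4-HOST
l.19452, `D69-REV22/dryrun-skel/K1Skeleton13SepCoPRv4.lean`; the tree twin `IsRecordOfRecord₁₃CSepCoPRS` is WANTED there — until it lands the class is spelled INLINE here, verbatim at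
generic `N`).  The S-binding re-binds `b8` only, so N08 at the S-bound [B10]-pinned world is the CoPR storey's `b10_main_of_upS_pinB10` (`Iff.rfl` through `withB8`) -/

section CurrencyS

/-- **AT THE v1.6 DATUM OF ANY ADMISSIBLE STAGE-13 TUPLE WITH THE v1.6 PROVISOS, an S-BOUND world (block size `θ.L`, window `θ.γ`) IN THE S-CLASS OF `datumOfRecord₁₃SepCoPR F N θ h`
(presenting parameter `θ' := θ.pinB10`: admissibility read at it, THE SAME datum by `datumOfRecord₁₃SepCoPR_pinB10`, the S-binding of record over `θ'.toStage5₁₃CoPR`), carrying N08 at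
every run — from the one slot instance `PrintedUV3V N θ.L`** (the S-class text = plan's `RecordS` ∕ WANTED `IsRecordOfRecord₁₃CSepCoPRS`, inlined).
[cite: Balaban1985UV3, Thm 1 p.257, Thm 2 p.272; Balaban1989LargeFieldII, Thm 1 + (0.1) pp.355–356; Balaban1985RegularSpaces, Thm 8 p.101 (the S-binding's `b8`; bookkeeping)] -/
theorem exists_worldS₁₃CSepCoPR_b10_main_of_slot (θ : Stage13RParams F N) (h : θ.Provisos₁₃SepCoPR F N) (hθ : θ.Admissible F N) (hUV : PrintedUV3V N θ.L) :
    ∃ w : WorldP,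
      (∃ (θ' : Stage13RParams F N) (h' : θ'.Provisos₁₃SepCoPR F N), θ'.Admissible F N ∧
        datumOfRecord₁₃SepCoPR F N θ h = datumOfRecord₁₃SepCoPR F N θ' h' ∧ w.C = (datumOfRecord₁₃SepCoPR F N θ h).C ∧ (0 < w.γ ∧ w.γ ≤ θ'.γ) ∧
        w.L = (θ'.L : ℝ) ∧ ∀ P : B12.RunParams, w.up P = upOfRecord₅CS F N (θ'.toStage5₁₃CoPR F N) P) ∧
      ∀ P : B12.RunParams, Dag.B10_main (leavesP w P) := by
  obtain ⟨w₀⟩ := nonempty_worldP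
  refine ⟨{ w₀ with
      C := (datumOfRecord₁₃SepCoPR F N θ h).C, γ := θ.γ, L := (θ.L : ℝ), one_lt_L := by exact_mod_cast θ.hL.2,
      up := fun P => upOfRecord₅CS F N ((θ.pinB10 F N).toStage5₁₃CoPR F N) P }, ⟨θ.pinB10 F N, h.pinB10,
    (Stage13Params.pinB10_admissible_iff F N θ.toStage13Params).2 hθ, (datumOfRecord₁₃SepCoPR_pinB10 F N θ h).symm, rfl, ⟨hθ.toStage9.gamma_pos, le_rfl⟩, rfl, fun _ => rfl⟩, ?_⟩
  exact b10_main_of_upS_pinB10 θ (fun _ => rfl) hUV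

/-- **«THE K0⁶ ANTECEDENT ⟹ N08's SLICE OF THE REGISTERED RUNG 1 v4 `NodesAtSomeRecord13PWS`»**, `N = 2`: from `∃ θ, Provisos₁₃SepCoPR ∧ (ZrUnity ∧ SlotsNondegenerate₁₃) ∧ Admissible` at `F`
(HYPOTHESIS `hI` = the K0⁶ body at `F` VERBATIM) and the slot of record at every odd `L > 1` (HYPOTHESIS `hUV`, N08's object gap): SOME guarded admissible `θ`, provisos `h` and world `w` with
`w` IN THE S-CLASS OF `datumOfRecord₁₃SepCoPR F 2 θ h` (plan's `RecordS F θ h w`, inlined), `Dag.B10_main` at every run, AND the pin `PrintedUV3V 2 θ.L` — i.e. rung 1 v4's text with the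
twelve other node conjuncts and the N12 selector conjunct removed.  NOT the stub, NOT a discharge. [cite: Balaban1985UV3, Thm 1 p.257, Thm 2 p.272; Balaban1989LargeFieldII, Thm 1 + (0.1) pp.355–356; Balaban1988Convergent, (3.16)–(3.22) pp.268–269 (bookkeeping)] -/
theorem exists_guarded_recordS₁₃CSepCoPR_b10_main_of_inhabited13SepCoPR_two (F : T4Family)
    (hI : ∃ θ : Stage13RParams F 2, θ.Provisos₁₃SepCoPR F 2 ∧ (θ.ZrUnity F 2 ∧ θ.SlotsNondegenerate₁₃ F 2) ∧ θ.Admissible F 2)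
    (hUV : ∀ L : ℕ, Odd L → 1 < L → PrintedUV3V 2 L) :
    ∃ (θ : Stage13RParams F 2) (h : θ.Provisos₁₃SepCoPR F 2) (w : WorldP), (θ.ZrUnity F 2 ∧ θ.SlotsNondegenerate₁₃ F 2) ∧ θ.Admissible F 2 ∧
      (∃ (θ' : Stage13RParams F 2) (h' : θ'.Provisos₁₃SepCoPR F 2), θ'.Admissible F 2 ∧
        datumOfRecord₁₃SepCoPR F 2 θ h = datumOfRecord₁₃SepCoPR F 2 θ' h' ∧ w.C = (datumOfRecord₁₃SepCoPR F 2 θ h).C ∧ (0 < w.γ ∧ w.γ ≤ θ'.γ) ∧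
        w.L = (θ'.L : ℝ) ∧ ∀ P : B12.RunParams, w.up P = upOfRecord₅CS F 2 (θ'.toStage5₁₃CoPR F 2) P) ∧
      (∀ P : B12.RunParams, Dag.B10_main (leavesP w P)) ∧ PrintedUV3V 2 θ.L := by
  obtain ⟨θ, h, hG, hθ⟩ := hI
  obtain ⟨w, hS, hN⟩ := exists_worldS₁₃CSepCoPR_b10_main_of_slot θ h hθ (hUV θ.L θ.hL.1 θ.hL.2)
  exact ⟨θ, h, w, hG, hθ, hS, hN, hUV θ.L θ.hL.1 θ.hL.2⟩

end CurrencyS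

/-! ## §3 ON THE STAGE-13 WITNESS LINE OF RECORD `θ₁₃ = theta13LiveOfRecord F N` (block size `F.L`, window `γ = 1∕2`) — N08's share costs `PrintedUV3V N F.L`; the guard
is K0a's HYPOTHESIS-FREE row P12 (`Record13LiveSelectorFamily` v1.1) -/

section WitnessLine
variable (F N) (Zr : (p : B12.RunParams) → TkResidualW F N (FluctV N) p.K)

/-- **N08's SHARE OF THE rev-20 NODES STUB ON THE WITNESS LINE OF RECORD COSTS THE SINGLE PROP `PrintedUV3V N F.L`** (plus K0's own v1.6 provisos `hP` at `θ₁₃`,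
HYPOTHESIS; admissibility is K0a's THEOREM `admissible_theta13LiveOfRecord`): a world of `datumOfRecord₁₃SepCoPR F N θ₁₃ hP` (`w.γ = 1∕2`, `w.L = F.L`), bound over the
[B10]-pinned view of `θ₁₃`, that is a ₁₃CSepCoPR record and carries N08 at every run.  At `N = 2`: [Balaban1985UV3] Thm 1-compact ∧ Thm 2 with their printed ∃-prefix for SU(2)
at the family's block size `F.L`, at some version of print's transformations. [cite: Balaban1985UV3, Thm 1 p.257, Thm 2 p.272; Balaban1989LargeFieldII, Thm 1 + (0.1) pp.355–356; Balaban1987RG1, (0.21) p.256 (bookkeeping)] -/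
theorem exists_world₁₃CSepCoPR_b10_main_at_theta13LiveOfRecord (hP : (⟨theta13LiveOfRecord F N, Zr⟩ : Stage13RParams F N).Provisos₁₃SepCoPR F N) (hUV : PrintedUV3V N F.L) :
    ∃ w : WorldP, IsRecordOfRecord₁₃CSepCoPR F N (datumOfRecord₁₃SepCoPR F N (⟨theta13LiveOfRecord F N, Zr⟩ : Stage13RParams F N) hP) w ∧ w.γ = 1 / 2 ∧ w.L = (F.L : ℝ) ∧
      (∀ P, w.up P = upOfRecord₅C F N (((⟨theta13LiveOfRecord F N, Zr⟩ : Stage13RParams F N).pinB10 F N).toStage5₁₃CoPR F N) P) ∧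
      ∀ P : B12.RunParams, Dag.B10_main (leavesP w P) :=
  exists_world₁₃CSepCoPR_b10_main_of_slot (⟨theta13LiveOfRecord F N, Zr⟩ : Stage13RParams F N) hP (admissible_theta13LiveOfRecord F N) (γw := 1 / 2)
    ⟨one_half_pos, (N08AtRecord13.theta13LiveOfRecord_γ F N).symm.le⟩ hUV

/-- **N08's CONJUNCT OF RUNG 1, WITNESSED AT `θ₁₃` OF RECORD, `N = 2`, WITH ITS PIN** — from K0's open rows at the witness (`hP : θ₁₃.Provisos₁₃SepCoPR F 2`, HYPOTHESIS)
and `PrintedUV3V 2 F.L`: the guard is the DISPLAYED `hZ : ZrUnity` of the lift ∕ K0a's HYPOTHESIS-FREE `slotsNondegenerate₁₃_theta13LiveOfRecord_of_hasResiduals` and admissibility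
its `admissible_theta13LiveOfRecord`, BY NAME (no proviso row read).  NOT the stub, NOT a discharge. [cite: Balaban1985UV3, Thm 1 p.257, Thm 2 p.272; Balaban1988Convergent, Thm 1 p.262, (3.16)–(3.22) pp.268–269; Balaban1989LargeFieldI, (0.3)–(0.4) p.176 (bookkeeping)] -/
theorem exists_guarded_record₁₃CSepCoPR_b10_main_of_theta13Live_provisosSepCoPR_two (F : T4Family) (Zr : (p : B12.RunParams) → TkResidualW F 2 (FluctV 2) p.K) (hP : (⟨theta13LiveOfRecord F 2, Zr⟩ : Stage13RParams F 2).Provisos₁₃SepCoPR F 2)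
    (hZ : (⟨theta13LiveOfRecord F 2, Zr⟩ : Stage13RParams F 2).ZrUnity F 2) (hUV : PrintedUV3V 2 F.L) :
    ∃ (θ : Stage13RParams F 2) (h : θ.Provisos₁₃SepCoPR F 2) (w : WorldP), (θ.ZrUnity F 2 ∧ θ.SlotsNondegenerate₁₃ F 2) ∧ θ.Admissible F 2 ∧
      IsRecordOfRecord₁₃CSepCoPR F 2 (datumOfRecord₁₃SepCoPR F 2 θ h) w ∧ (∀ P : B12.RunParams, Dag.B10_main (leavesP w P)) ∧ PrintedUV3V 2 θ.L := by
  obtain ⟨w, hR, -, -, -, hN⟩ := exists_world₁₃CSepCoPR_b10_main_at_theta13LiveOfRecord F 2 Zr hP hUV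
  exact ⟨_, hP, w, ⟨hZ, slotsNondegenerate₁₃_theta13LiveOfRecord_of_hasResiduals F 2⟩,
    admissible_theta13LiveOfRecord F 2, hR, hN, hUV⟩

end WitnessLine

/-! ## §4 AT K0a's STAGE-13 WITNESS FAMILIES — the all-numerics family `θ₁₃(n, ε₂₉)` (`γ = n.γ`) and the two-letter family `θ₁₃(ε₀, ε₂₉)` (`γ = 1∕2`), block size
`F.L`; v1.6 provisos OPAQUE, guard HYPOTHESIS-FREE -/

section Numerics
variable (F : T4Family) (N : ℕ) [NeZero N] (Zr : (p : B12.RunParams) → TkResidualW F N (FluctV N) p.K) {n : Stage12Numerics} {ε₂₉ : ℝ}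

/-- **N08's SHARE OF THE rev-20 NODES STUB AT ANY MEMBER `θ₁₃(n, ε₂₉)` COSTS THE SINGLE PROP `PrintedUV3V N F.L`** (plus the member's v1.6 provisos `hP`, HYPOTHESIS, and
the two displayed signs `n.Pos`, `0 < ε₂₉` under which K0a's `admissible_theta13LiveOfNumerics` gives admissibility): a world of the member's v1.6 datum (`w.γ = n.γ`,
`w.L = F.L`), bound over the [B10]-pinned Stage-13 view of the member, that IS a ₁₃CSepCoPR record and carries N08 at every run (§2 `exists_world₁₃CSepCoPR_b10_main_of_slot`).
[cite: Balaban1985UV3, Thm 1 p.257, Thm 2 p.272; Balaban1989LargeFieldII, Thm 1 + (0.1) pp.355–356; Balaban1987RG1, (0.21) p.256, (2.9) p.266 (bookkeeping)] -/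
theorem exists_world₁₃CSepCoPR_b10_main_at_theta13LiveOfNumerics (hn : n.Pos) (hε' : 0 < ε₂₉)
    (hP : (⟨theta13LiveOfNumerics F N n ε₂₉ (zeta316OfRecord F N n.ν n.τ9.M n.A₁) (RzOfRecord F N) (ZtOfRecord F N), Zr⟩ : Stage13RParams F N).Provisos₁₃SepCoPR F N)
    (hUV : PrintedUV3V N F.L) :
    ∃ w : WorldP,
      IsRecordOfRecord₁₃CSepCoPR F N
          (datumOfRecord₁₃SepCoPR F N (⟨theta13LiveOfNumerics F N n ε₂₉ (zeta316OfRecord F N n.ν n.τ9.M n.A₁) (RzOfRecord F N) (ZtOfRecord F N), Zr⟩ : Stage13RParams F N) hP) w ∧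
        w.γ = n.γ ∧ w.L = (F.L : ℝ) ∧
        (∀ P, w.up P = upOfRecord₅C F N
          (((⟨theta13LiveOfNumerics F N n ε₂₉ (zeta316OfRecord F N n.ν n.τ9.M n.A₁) (RzOfRecord F N) (ZtOfRecord F N), Zr⟩ : Stage13RParams F N).pinB10 F N).toStage5₁₃CoPR F N) P) ∧
        ∀ P : B12.RunParams, Dag.B10_main (leavesP w P) :=
  have hθ := admissible_theta13LiveOfNumerics F N (zeta316OfRecord F N n.ν n.τ9.M n.A₁) (RzOfRecord F N) (ZtOfRecord F N) hn hε'
  exists_world₁₃CSepCoPR_b10_main_of_slot _ hP hθ (γw := n.γ) ⟨hθ.toStage9.gamma_pos, le_rfl⟩ hUV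

/-- **N08's CONJUNCT OF RUNG 1, WITNESSED AT THE MEMBER `θL F n ε₂₉`, `N = 2`, WITH ITS PIN** — from the member's v1.6 provisos (`hP`, HYPOTHESIS), the signs
`n.Pos`, `0 < ε₂₉`, and `PrintedUV3V 2 F.L`: the guard is the DISPLAYED `hZ : ZrUnity` of the lift ∕ K0a's HYPOTHESIS-FREE `slotsNondegenerate₁₃_theta13LiveOfNumerics_of_hasResiduals`
and admissibility its `admissible_theta13LiveOfNumerics`, BY NAME.  NOT the stub, NOT a discharge. [cite: Balaban1985UV3, Thm 1 p.257, Thm 2 p.272; Balaban1988Convergent, Thm 1 p.262, (3.16)–(3.22) pp.268–269; Balaban1989LargeFieldI, (0.3)–(0.4) p.176 (bookkeeping)] -/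
theorem exists_guarded_record₁₃CSepCoPR_b10_main_of_theta13Numerics_provisosSepCoPR_two (F : T4Family) (Zr : (p : B12.RunParams) → TkResidualW F 2 (FluctV 2) p.K) {n : Stage12Numerics} {ε₂₉ : ℝ} (hn : n.Pos)
    (hε' : 0 < ε₂₉)
    (hP : (⟨theta13LiveOfNumerics F 2 n ε₂₉ (zeta316OfRecord F 2 n.ν n.τ9.M n.A₁) (RzOfRecord F 2) (ZtOfRecord F 2), Zr⟩ : Stage13RParams F 2).Provisos₁₃SepCoPR F 2)
    (hZ : (⟨theta13LiveOfNumerics F 2 n ε₂₉ (zeta316OfRecord F 2 n.ν n.τ9.M n.A₁) (RzOfRecord F 2) (ZtOfRecord F 2), Zr⟩ : Stage13RParams F 2).ZrUnity F 2) (hUV : PrintedUV3V 2 F.L) :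
    ∃ (θ : Stage13RParams F 2) (h : θ.Provisos₁₃SepCoPR F 2) (w : WorldP), (θ.ZrUnity F 2 ∧ θ.SlotsNondegenerate₁₃ F 2) ∧ θ.Admissible F 2 ∧
      IsRecordOfRecord₁₃CSepCoPR F 2 (datumOfRecord₁₃SepCoPR F 2 θ h) w ∧ (∀ P : B12.RunParams, Dag.B10_main (leavesP w P)) ∧ PrintedUV3V 2 θ.L := by
  obtain ⟨w, hR, -, -, -, hN⟩ := exists_world₁₃CSepCoPR_b10_main_at_theta13LiveOfNumerics F 2 Zr hn hε' hP hUV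
  exact ⟨_, hP, w, ⟨hZ, slotsNondegenerate₁₃_theta13LiveOfNumerics_of_hasResiduals F 2 n ε₂₉⟩,
    admissible_theta13LiveOfNumerics F 2 _ _ _ hn hε', hR, hN, hUV⟩

/-- **THE SAME AT node00-def-K0a's PIN OF RECORD `Zr := ZrOfRecord₁₃ F 2 θL`** (FILE 17 `Node00/Record13ResidualsR`: dag-n11-d's diagonal cure made a definition; K0a g9: «the cured
witness = `⟨θ₁₅…, ZrOfRecord₁₃ F 2 θ₁₅…⟩`», a lift of a member of this family): the guard's `ZrUnity` half IS K0a's `finsum_ζ0_ZrOfRecord₁₃` (every generation, every run), so at the cured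
lift N08's conjunct costs EXACTLY what it cost at ⁵ — the provisos there (HYPOTHESIS, opaque), the signs, and `PrintedUV3V 2 F.L`.  NOT the stub, NOT a discharge.
[cite: Balaban1985UV3, Thm 1 p.257, Thm 2 p.272; Balaban1988Convergent, (1.11) p.248, (3.16)–(3.22) pp.268–269; Balaban1989LargeFieldI, (0.3)–(0.4) p.176 (bookkeeping)] -/
theorem exists_guarded_record₁₃CSepCoPR_b10_main_of_theta13Numerics_provisosSepCoPR_two_at_ZrOfRecord₁₃ (F : T4Family) {n : Stage12Numerics} {ε₂₉ : ℝ} (hn : n.Pos)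
    (hε' : 0 < ε₂₉)
    (hP : (⟨theta13LiveOfNumerics F 2 n ε₂₉ (zeta316OfRecord F 2 n.ν n.τ9.M n.A₁) (RzOfRecord F 2) (ZtOfRecord F 2),
      ZrOfRecord₁₃ F 2 (theta13LiveOfNumerics F 2 n ε₂₉ (zeta316OfRecord F 2 n.ν n.τ9.M n.A₁) (RzOfRecord F 2) (ZtOfRecord F 2))⟩ : Stage13RParams F 2).Provisos₁₃SepCoPR F 2)
    (hUV : PrintedUV3V 2 F.L) :
    ∃ (θ : Stage13RParams F 2) (h : θ.Provisos₁₃SepCoPR F 2) (w : WorldP), (θ.ZrUnity F 2 ∧ θ.SlotsNondegenerate₁₃ F 2) ∧ θ.Admissible F 2 ∧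
      IsRecordOfRecord₁₃CSepCoPR F 2 (datumOfRecord₁₃SepCoPR F 2 θ h) w ∧ (∀ P : B12.RunParams, Dag.B10_main (leavesP w P)) ∧ PrintedUV3V 2 θ.L :=
  exists_guarded_record₁₃CSepCoPR_b10_main_of_theta13Numerics_provisosSepCoPR_two F _ hn hε' hP (fun _ j ω => finsum_ζ0_ZrOfRecord₁₃ j ω) hUV

end Numerics

section Family₂
variable (F : T4Family) (N : ℕ) [NeZero N] (Zr : (p : B12.RunParams) → TkResidualW F N (FluctV N) p.K) {ε₀ ε₂₉ : ℝ}

/-- **N08's SHARE AT ANY MEMBER `θ₁₃(ε₀, ε₂₉)` OF THE TWO-LETTER FAMILY COSTS `PrintedUV3V N F.L`** (plus the member's v1.6 provisos `hP` and the signs `0 < ε₀`,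
`0 < ε₂₉`; admissibility is K0a's `admissible_theta13LiveOfFamily₂`): a world of the member's v1.6 datum (`w.γ = 1∕2`, `w.L = F.L`) bound over the [B10]-pinned CoPR view,
a ₁₃CSepCoPR record carrying N08 at every run. [cite: Balaban1985UV3, Thm 1 p.257, Thm 2 p.272; Balaban1989LargeFieldII, Thm 1 + (0.1) pp.355–356; Balaban1987RG1, (1.2) p.260, (2.9) p.266 (bookkeeping)] -/
theorem exists_world₁₃CSepCoPR_b10_main_at_theta13LiveOfFamily₂ (hε : 0 < ε₀) (hε' : 0 < ε₂₉)
    (hP : (⟨theta13LiveOfFamily₂ F N ε₀ ε₂₉ (zeta316OfRecord F N (numerics7OfFamily ε₀) 1 1) (RzOfRecord F N) (ZtOfRecord F N), Zr⟩ : Stage13RParams F N).Provisos₁₃SepCoPR F N)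
    (hUV : PrintedUV3V N F.L) :
    ∃ w : WorldP,
      IsRecordOfRecord₁₃CSepCoPR F N
          (datumOfRecord₁₃SepCoPR F N (⟨theta13LiveOfFamily₂ F N ε₀ ε₂₉ (zeta316OfRecord F N (numerics7OfFamily ε₀) 1 1) (RzOfRecord F N) (ZtOfRecord F N), Zr⟩ : Stage13RParams F N) hP) w ∧
        w.γ = 1 / 2 ∧ w.L = (F.L : ℝ) ∧
        (∀ P, w.up P = upOfRecord₅C F N
          (((⟨theta13LiveOfFamily₂ F N ε₀ ε₂₉ (zeta316OfRecord F N (numerics7OfFamily ε₀) 1 1) (RzOfRecord F N) (ZtOfRecord F N), Zr⟩ : Stage13RParams F N).pinB10 F N).toStage5₁₃CoPR F N) P) ∧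
        ∀ P : B12.RunParams, Dag.B10_main (leavesP w P) :=
  exists_world₁₃CSepCoPR_b10_main_of_slot _ hP (admissible_theta13LiveOfFamily₂ F N _ _ _ hε hε') (γw := 1 / 2)
    ⟨one_half_pos, (theta13LiveOfFamily₂_γ F N ε₀ ε₂₉ _ _ _).symm.le⟩ hUV

/-- **N08's CONJUNCT OF RUNG 1, WITNESSED AT THE MEMBER `θ₁₃(ε₀, ε₂₉)`, `N = 2`, WITH ITS PIN** — from the member's v1.6 provisos (`hP`, HYPOTHESIS), `0 < ε₀`,
`0 < ε₂₉` and `PrintedUV3V 2 F.L`; the guard is the DISPLAYED `hZ : ZrUnity` of the lift ∕ K0a's HYPOTHESIS-FREE `slotsNondegenerate₁₃_theta13LiveOfFamily₂_of_hasResiduals`, admissibility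
its `admissible_theta13LiveOfFamily₂`, BY NAME.  NOT the stub, NOT a discharge. [cite: Balaban1985UV3, Thm 1 p.257, Thm 2 p.272; Balaban1988Convergent, Thm 1 p.262, (3.16)–(3.22) pp.268–269; Balaban1989LargeFieldI, (0.3)–(0.4) p.176 (bookkeeping)] -/
theorem exists_guarded_record₁₃CSepCoPR_b10_main_of_theta13Family₂_provisosSepCoPR_two (F : T4Family) (Zr : (p : B12.RunParams) → TkResidualW F 2 (FluctV 2) p.K) {ε₀ ε₂₉ : ℝ} (hε : 0 < ε₀) (hε' : 0 < ε₂₉)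
    (hP : (⟨theta13LiveOfFamily₂ F 2 ε₀ ε₂₉ (zeta316OfRecord F 2 (numerics7OfFamily ε₀) 1 1) (RzOfRecord F 2) (ZtOfRecord F 2), Zr⟩ : Stage13RParams F 2).Provisos₁₃SepCoPR F 2)
    (hZ : (⟨theta13LiveOfFamily₂ F 2 ε₀ ε₂₉ (zeta316OfRecord F 2 (numerics7OfFamily ε₀) 1 1) (RzOfRecord F 2) (ZtOfRecord F 2), Zr⟩ : Stage13RParams F 2).ZrUnity F 2) (hUV : PrintedUV3V 2 F.L) :
    ∃ (θ : Stage13RParams F 2) (h : θ.Provisos₁₃SepCoPR F 2) (w : WorldP), (θ.ZrUnity F 2 ∧ θ.SlotsNondegenerate₁₃ F 2) ∧ θ.Admissible F 2 ∧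
      IsRecordOfRecord₁₃CSepCoPR F 2 (datumOfRecord₁₃SepCoPR F 2 θ h) w ∧ (∀ P : B12.RunParams, Dag.B10_main (leavesP w P)) ∧ PrintedUV3V 2 θ.L := by
  obtain ⟨w, hR, -, -, -, hN⟩ := exists_world₁₃CSepCoPR_b10_main_at_theta13LiveOfFamily₂ F 2 Zr hε hε' hP hUV
  exact ⟨_, hP, w, ⟨hZ, slotsNondegenerate₁₃_theta13LiveOfFamily₂_of_hasResiduals F 2 ε₀ ε₂₉⟩,
    admissible_theta13LiveOfFamily₂ F 2 _ _ _ hε hε', hR, hN, hUV⟩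

end Family₂

end Summit.QuantumFields.YangMills.BalabanUVNodes.N08AtRecord13SepCoPR

end
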